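import Summits.ResolutionOfSingularities.ResolutionOfSingularities.Theorems.RadicialJungCleanModelsCcurvePersistConormal
import HarnessLib

/-!
# Route `RadicialJung`, crux `CleanModels` (stmt-15917) — (C-curve) sub-line: row decompositions along the centre curve and their transforms under point blow-ups

Lead `res-B-lead-1` g7 (plan `Cruxes/CleanModels/Lines/Sketch-memo-Ccurve-plan.md` §1 S5; workfile `Lines/Sketch_Ccurve_assembly.lean` v2.8, stubs
`stub_Cc_persistForm1/3`).  OURS · counted 0.  Nothing here proves resolution in characteristic `p`; resolution in char `p` is NOT proved.

Setting: `S' = locAtCentre B' O` regular of dimension 3 with r.s.p. `(x, y, z)`, `O ≤ O₁`, curve characterisation `hcen` (`(x, y)` = centre of `O₁`).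
* `row_decomp` — a row `(α, β)` of elements of `S'`, not both in `(x, y)`, is `(a' z^e + x a₁ + y a₂, b' z^e + x b₁ + y b₂)` with a COMMON order `e` and
  `(a', b')` unimodular (`v a' = 1 ∨ v b' = 1`) — the `z̄`-adic leading term of the row in the DVR `S' ⧸ (x, y)`;
* `lift_term` — after `n ≥ e` point blow-ups (`x = x_n z^n`, `y = y_n z^n` in a bigger local ring `S⁺ ∋ x_n, y_n` of the same kind),
  `a' z^e + x a₁ + y a₂ = z^e · u` with `u = a' + z^{n-e}(x_n a₁ + y_n a₂) ∈ S⁺`, `u` a unit iff `a'` is;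
* `lift_row` — hence `x α + y β = z^{n+e} (u x_n + v y_n)` with `(u, v)` unimodular in `S⁺`.
-/

noncomputable section

set_option linter.dupNamespace false

open IsLocalRing Literature.AlgebraicGeometry.Resolution
open Summit.ResolutionOfSingularities.ResolutionOfSingularities.Theorems

namespace Summit.ResolutionOfSingularities.ResolutionOfSingularities.Theorems.RadicialJung.CleanModels.Ccurve

variable {K : Type} [Field K]

/-- **Row decomposition along the centre curve.**  For `α, β ∈ S'` not both of `v₁`-value `< 1`: a common order `e` and `a', b', a₁, a₂, b₁, b₂ ∈ S'` with
`α = a' z^e + x a₁ + y a₂`, `β = b' z^e + x b₁ + y b₂` and `(a', b')` unimodular. [folklore] -/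
theorem row_decomp {B' : Subring K} {O O₁ : ValuationSubring K} (hB'O : B' ≤ O.toSubring) (hOO₁ : O ≤ O₁)
    [IsRegularLocalRing ↥(locAtCentre B' O)] (hdim : ringKrullDim ↥(locAtCentre B' O) = 3)
    {x y z : K} (hx : x ∈ locAtCentre B' O) (hy : y ∈ locAtCentre B' O) (hz : z ∈ locAtCentre B' O)
    (hmax : (haveI := isLocalRing_locAtCentre hB'O; IsLocalRing.maximalIdeal (locAtCentre B' O)) =
        Ideal.span {⟨x, hx⟩, ⟨y, hy⟩, ⟨z, hz⟩})
    (hcen : ∀ w : ↥(locAtCentre B' O), O₁.valuation (w : K) < 1 ↔ w ∈ Ideal.span ({⟨x, hx⟩, ⟨y, hy⟩} : Set ↥(locAtCentre B' O)))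
    {α β : K} (hα : α ∈ locAtCentre B' O) (hβ : β ∈ locAtCentre B' O) (htr : O₁.valuation α = 1 ∨ O₁.valuation β = 1) :
    ∃ (e : ℕ) (a' b' a₁ a₂ b₁ b₂ : K), a' ∈ locAtCentre B' O ∧ b' ∈ locAtCentre B' O ∧ a₁ ∈ locAtCentre B' O ∧ a₂ ∈ locAtCentre B' O ∧
      b₁ ∈ locAtCentre B' O ∧ b₂ ∈ locAtCentre B' O ∧
      α = a' * z ^ e + x * a₁ + y * a₂ ∧ β = b' * z ^ e + x * b₁ + y * b₂ ∧ (O.valuation a' = 1 ∨ O.valuation b' = 1) := by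
  classical
  set S' := locAtCentre B' O with hS'
  have h0S : (0 : K) ∈ S' := Subring.zero_mem _
  -- an element of `v₁`-value `< 1` lies in `(x, y)`
  have hsmall : ∀ {γ : K} (hγ : γ ∈ S'), O₁.valuation γ ≠ 1 → ∃ c₁ c₂ : K, c₁ ∈ S' ∧ c₂ ∈ S' ∧ γ = x * c₁ + y * c₂ := by
    intro γ hγ hne
    have hlt : O₁.valuation γ < 1 := lt_of_le_of_ne ((O₁.valuation_le_one_iff _).mpr (hOO₁ (locAtCentre_le hB'O hγ))) hne
    obtain ⟨c₁, c₂, hc₁, hc₂, hrel⟩ := (mem_span_pair_iff_exists hγ hx hy).mp ((hcen ⟨γ, hγ⟩).mp hlt)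
    exact ⟨c₁, c₂, hc₁, hc₂, hrel⟩
  by_cases hvα : O₁.valuation α = 1
  · obtain ⟨e₁, U, a₁, a₂, hU, ha₁, ha₂, hvU, hαeq⟩ := exists_eq_unit_mul_pow_add_K hB'O hOO₁ hdim hx hy hz hmax hcen hα hvα
    by_cases hvβ : O₁.valuation β = 1
    · obtain ⟨e₂, U', b₁, b₂, hU', hb₁, hb₂, hvU', hβeq⟩ := exists_eq_unit_mul_pow_add_K hB'O hOO₁ hdim hx hy hz hmax hcen hβ hvβ
      rcases le_or_gt e₁ e₂ with hle | hlt
      · refine ⟨e₁, U, U' * z ^ (e₂ - e₁), a₁, a₂, b₁, b₂, hU, Subring.mul_mem _ hU' (Subring.pow_mem _ hz _), ha₁, ha₂, hb₁, hb₂,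
          hαeq, ?_, Or.inl hvU⟩
        rw [hβeq, mul_assoc, ← pow_add, Nat.sub_add_cancel hle]
      · refine ⟨e₂, U * z ^ (e₁ - e₂), U', a₁, a₂, b₁, b₂, Subring.mul_mem _ hU (Subring.pow_mem _ hz _), hU', ha₁, ha₂, hb₁, hb₂,
          ?_, hβeq, Or.inr hvU'⟩
        rw [hαeq, mul_assoc, ← pow_add, Nat.sub_add_cancel hlt.le]
    · obtain ⟨b₁, b₂, hb₁, hb₂, hβeq⟩ := hsmall hβ hvβ
      refine ⟨e₁, U, 0, a₁, a₂, b₁, b₂, hU, h0S, ha₁, ha₂, hb₁, hb₂, hαeq, ?_, Or.inl hvU⟩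
      rw [hβeq]; ring
  · have hvβ : O₁.valuation β = 1 := htr.resolve_left hvα
    obtain ⟨e₂, U', b₁, b₂, hU', hb₁, hb₂, hvU', hβeq⟩ := exists_eq_unit_mul_pow_add_K hB'O hOO₁ hdim hx hy hz hmax hcen hβ hvβ
    obtain ⟨a₁, a₂, ha₁, ha₂, hαeq⟩ := hsmall hα hvα
    refine ⟨e₂, 0, U', a₁, a₂, b₁, b₂, h0S, hU', ha₁, ha₂, hb₁, hb₂, ?_, hβeq, Or.inr hvU'⟩
    rw [hαeq]; ring

/-- **Lifting a term through `n ≥ e` point blow-ups.**  With `x = x_n z^n`, `y = y_n z^n` (`x_n, y_n` of value `< 1` in a local ring `S⁺ ⊇ S'` of the same kind):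
`a' z^e + x a₁ + y a₂ = z^e · u`, `u = a' + z^{n-e} (x_n a₁ + y_n a₂) ∈ S⁺`, and `u` is a unit iff `a'` is. [folklore] -/
theorem lift_term {R : Subring K} {O : ValuationSubring K} (hRO : R ≤ O.toSubring)
    {x y z xn yn a' a₁ a₂ : K} (hz : z ∈ R) (hxn : xn ∈ R) (hyn : yn ∈ R) (ha' : a' ∈ R) (ha₁ : a₁ ∈ R) (ha₂ : a₂ ∈ R)
    (hvxn : O.valuation xn < 1) (hvyn : O.valuation yn < 1) {n e : ℕ} (hen : e ≤ n) (hxe : x = xn * z ^ n) (hye : y = yn * z ^ n) :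
    ∃ u : K, u ∈ R ∧ a' * z ^ e + x * a₁ + y * a₂ = z ^ e * u ∧
      (O.valuation a' = 1 → O.valuation u = 1) ∧ (O.valuation a' < 1 → O.valuation u < 1) := by
  set u : K := a' + z ^ (n - e) * (xn * a₁ + yn * a₂) with hu
  have htail_mem : z ^ (n - e) * (xn * a₁ + yn * a₂) ∈ R :=
    Subring.mul_mem _ (Subring.pow_mem _ hz _) (Subring.add_mem _ (Subring.mul_mem _ hxn ha₁) (Subring.mul_mem _ hyn ha₂))
  have htail : O.valuation (z ^ (n - e) * (xn * a₁ + yn * a₂)) < 1 := by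
    have h1 : O.valuation (xn * a₁ + yn * a₂) < 1 :=
      lt_of_le_of_lt (Valuation.map_add _ _ _)
        (max_lt (valuation_mul_lt_one_of_lt_of_mem O hvxn (hRO ha₁)) (valuation_mul_lt_one_of_lt_of_mem O hvyn (hRO ha₂)))
    rw [mul_comm]
    exact valuation_mul_lt_one_of_lt_of_mem O h1 (hRO (Subring.pow_mem _ hz _))
  refine ⟨u, Subring.add_mem _ ha' htail_mem, ?_, fun h => valuation_add_eq_one_of_lt O h htail, fun h => ?_⟩
  · rw [hu, hxe, hye]
    have : z ^ n = z ^ (n - e) * z ^ e := by rw [← pow_add, Nat.sub_add_cancel hen]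
    rw [this]; ring
  · exact lt_of_le_of_lt (Valuation.map_add _ _ _) (max_lt h htail)

/-- **Lifting a row.**  With the row decomposition of `(α, β)` at order `e` and `n ≥ e` point blow-ups: `x α + y β = z^{n+e} (u x_n + v y_n)` with `u, v ∈ S⁺` and
`(u, v)` unimodular exactly as `(a', b')`. [folklore] -/
theorem lift_row {R : Subring K} {O : ValuationSubring K} (hRO : R ≤ O.toSubring)
    {x y z xn yn a' b' a₁ a₂ b₁ b₂ : K} (hz : z ∈ R) (hxn : xn ∈ R) (hyn : yn ∈ R) (ha' : a' ∈ R) (hb' : b' ∈ R)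
    (ha₁ : a₁ ∈ R) (ha₂ : a₂ ∈ R) (hb₁ : b₁ ∈ R) (hb₂ : b₂ ∈ R)
    (hvxn : O.valuation xn < 1) (hvyn : O.valuation yn < 1) {n e : ℕ} (hen : e ≤ n) (hxe : x = xn * z ^ n) (hye : y = yn * z ^ n) :
    ∃ u v : K, u ∈ R ∧ v ∈ R ∧
      x * (a' * z ^ e + x * a₁ + y * a₂) + y * (b' * z ^ e + x * b₁ + y * b₂) = z ^ (n + e) * (u * xn + v * yn) ∧
      (O.valuation a' = 1 → O.valuation u = 1) ∧ (O.valuation a' < 1 → O.valuation u < 1) ∧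
      (O.valuation b' = 1 → O.valuation v = 1) ∧ (O.valuation b' < 1 → O.valuation v < 1) := by
  obtain ⟨u, hu, hueq, hu1, hu2⟩ := lift_term hRO hz hxn hyn ha' ha₁ ha₂ hvxn hvyn hen hxe hye
  obtain ⟨v, hv, hveq, hv1, hv2⟩ := lift_term hRO hz hxn hyn hb' hb₁ hb₂ hvxn hvyn hen hxe hye
  refine ⟨u, v, hu, hv, ?_, hu1, hu2, hv1, hv2⟩
  rw [hueq, hveq, hxe, hye, pow_add]; ring

/-- In `locAtCentre B O` (`B ⊆ O`): value `≤ 1`. [folklore] -/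
theorem valuation_le_one_of_mem_locAtCentre {B : Subring K} {O : ValuationSubring K} (h : B ≤ O.toSubring) {w : K}
    (hw : w ∈ locAtCentre B O) : O.valuation w ≤ 1 :=
  (O.valuation_le_one_iff _).mpr (locAtCentre_le h hw)

/-- A member of the maximal ideal `(t₀, t₁, t₂)` of `locAtCentre B O` has value `< 1` (membership form for the three generators). [folklore] -/
theorem valuation_lt_one_of_gen {B : Subring K} {O : ValuationSubring K} (h : B ≤ O.toSubring)
    {t₀ t₁ t₂ : K} (h₀ : t₀ ∈ locAtCentre B O) (h₁ : t₁ ∈ locAtCentre B O) (h₂ : t₂ ∈ locAtCentre B O)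
    (hmax : (haveI := isLocalRing_locAtCentre h; IsLocalRing.maximalIdeal (locAtCentre B O)) = Ideal.span {⟨t₀, h₀⟩, ⟨t₁, h₁⟩, ⟨t₂, h₂⟩}) :
    O.valuation t₀ < 1 ∧ O.valuation t₁ < 1 ∧ O.valuation t₂ < 1 := by
  haveI := isLocalRing_locAtCentre h
  refine ⟨(mem_maximalIdeal_locAtCentre_iff h ⟨t₀, h₀⟩).mp ?_, (mem_maximalIdeal_locAtCentre_iff h ⟨t₁, h₁⟩).mp ?_,
    (mem_maximalIdeal_locAtCentre_iff h ⟨t₂, h₂⟩).mp ?_⟩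
  · rw [hmax]; exact Ideal.subset_span (by simp)
  · rw [hmax]; exact Ideal.subset_span (by simp)
  · rw [hmax]; exact Ideal.subset_span (by simp)

/-- `v₁ z = 1` for the third parameter: `z ∉ (x, y)` (minimality of the r.s.p.) and the curve characterisation. [folklore] -/
theorem valuation_coarse_z_eq_one {B' : Subring K} {O O₁ : ValuationSubring K} (hB'O : B' ≤ O.toSubring) (hOO₁ : O ≤ O₁)
    [IsRegularLocalRing ↥(locAtCentre B' O)] (hdim : ringKrullDim ↥(locAtCentre B' O) = 3)
    {x y z : K} (hx : x ∈ locAtCentre B' O) (hy : y ∈ locAtCentre B' O) (hz : z ∈ locAtCentre B' O)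
    (hmax : (haveI := isLocalRing_locAtCentre hB'O; IsLocalRing.maximalIdeal (locAtCentre B' O)) =
        Ideal.span {⟨x, hx⟩, ⟨y, hy⟩, ⟨z, hz⟩})
    (hcen : ∀ w : ↥(locAtCentre B' O), O₁.valuation (w : K) < 1 ↔ w ∈ Ideal.span ({⟨x, hx⟩, ⟨y, hy⟩} : Set ↥(locAtCentre B' O))) :
    O₁.valuation z = 1 ∧ O₁.valuation x < 1 ∧ O₁.valuation y < 1 := by
  haveI := isLocalRing_locAtCentre hB'O
  have hd : (maximalIdeal ↥(locAtCentre B' O)).spanFinrank = 3 := spanFinrank_eq_three_of_dim _ hdim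
  have hzns : (⟨z, hz⟩ : ↥(locAtCentre B' O)) ∉ Ideal.span ({⟨x, hx⟩, ⟨y, hy⟩} : Set _) :=
    not_mem_span_pair_of_rsp hd _ _ _ hmax
  refine ⟨(not_mem_span_pair_iff_valuation_eq_one hB'O hOO₁ hx hy hcen ⟨z, hz⟩).mp hzns,
    (hcen ⟨x, hx⟩).mpr (Ideal.subset_span (by simp)), (hcen ⟨y, hy⟩).mpr (Ideal.subset_span (by simp))⟩

end Summit.ResolutionOfSingularities.ResolutionOfSingularities.Theorems.RadicialJung.CleanModels.Ccurve

end
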